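import Mathlib
import Summits.MatrixMultiplication.MatrixMultiplication.Theorems.SnSubsetDichotomyHyperoctahedralThresholdRotationIdentity

/-!
# Returns inside the avoiding family: the local return bound
(crux `SnSubsetDichotomy.HyperoctahedralThreshold`, stmt-MatrixMultiplication-10883; siege seat k18, variation "twins ℓ² argument";
`--supports` helper, local companion of `…TwinCountBounds` (p115673) for the avoiding family of `…TwinAvoidFamily` (p116777))

Vocabulary of the line: involutions `μ c` of `Fin n`, `x · z := z.foldl (fun v c => μ c v) x`; `P'_D` = twin pre-pairs `(z, x, y)` of length `ℓ`
(z cyclically reduced, `x ≠ y` fixed) whose two trajectories avoid the vertex set `D`.  The local twins ℓ² reduction (`stub_twinsEll2Avoid`)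
needs `ℓ·(Ret₁ + Ret₂ + Ξ)(P'_D) < |P'_D|`; this file bounds the two RETURN terms by quantities living OUTSIDE `D`:

* `retLocal_snd_le_fst`:  `Ret₂(P'_D) ≤ Ret₁(P'_D)` (swap `x ↔ y`);
* `retLocal_fst_le`:  `Ret₁(P'_D) ≤ (N − 1) · RetD`, `RetD := #{(z, d, p) : 0 < d < ℓ, p·z = p, p·z.take d = p, the trajectory of p avoids D}`,
  whenever every cyclically reduced word of length `ℓ` has `≤ N` fixed points (poorness);
* `retD_le_sum`:  `RetD ≤ Σ_{d<ℓ} Σ_p cwᴰ_d(p) · cwᴰ_{ℓ−d}(p)`, `cwᴰ_m(p)` := number of reduced words `g` of length `m` closing at `p` ALL of whose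
  trajectory points `p · g.take i` (`i ≤ m`) avoid `D` — a per-vertex closed-walk count that a dense piece inside `D` cannot inflate.
So `Ret₁ + Ret₂ ≤ 2(N−1)·Σ_dΣ_p cwᴰ_d(p)cwᴰ_{ℓ−d}(p)`: the return terms of the local reduction are poorness × "no dense vertex outside D".
Pure finite combinatorics; no hypothesis on `μ`; no definitions.
-/

set_option linter.dupNamespace false

namespace Summit.MatrixMultiplication.MatrixMultiplication.Theorems.HyperoctahedralThreshold

namespace TwinsEll2

open Finset Rotation

variable {n : ℕ}

/-- **`Ret₂(P'_D) ≤ Ret₁(P'_D)`** by the swap `(z, x, y) ↦ (z, y, x)`, which preserves the avoiding family. -/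
theorem retLocal_snd_le_fst (μ : Fin 3 → Equiv.Perm (Fin n)) (D : Finset (Fin n)) (ℓ : ℕ) :
    ((((((univ : Finset (List.Vector (Fin 3) ℓ)).image (fun v => v.toList)).filter
        (fun z => List.IsChain (· ≠ ·) (z ++ z))) ×ˢ (univ : Finset (Fin n)) ×ˢ (univ : Finset (Fin n))).filter
        (fun t => t.1.foldl (fun v c => μ c v) t.2.1 = t.2.1 ∧ t.1.foldl (fun v c => μ c v) t.2.2 = t.2.2 ∧ t.2.1 ≠ t.2.2 ∧
          ∀ i < ℓ, (t.1.take i).foldl (fun v c => μ c v) t.2.1 ∉ D ∧ (t.1.take i).foldl (fun v c => μ c v) t.2.2 ∉ D) ×ˢ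
        range ℓ).filter (fun a => 0 < a.2 ∧ (a.1.1.take a.2).foldl (fun v c => μ c v) a.1.2.2 = a.1.2.2)).card ≤
    ((((((univ : Finset (List.Vector (Fin 3) ℓ)).image (fun v => v.toList)).filter
        (fun z => List.IsChain (· ≠ ·) (z ++ z))) ×ˢ (univ : Finset (Fin n)) ×ˢ (univ : Finset (Fin n))).filter
        (fun t => t.1.foldl (fun v c => μ c v) t.2.1 = t.2.1 ∧ t.1.foldl (fun v c => μ c v) t.2.2 = t.2.2 ∧ t.2.1 ≠ t.2.2 ∧
          ∀ i < ℓ, (t.1.take i).foldl (fun v c => μ c v) t.2.1 ∉ D ∧ (t.1.take i).foldl (fun v c => μ c v) t.2.2 ∉ D) ×ˢ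
        range ℓ).filter (fun a => 0 < a.2 ∧ (a.1.1.take a.2).foldl (fun v c => μ c v) a.1.2.1 = a.1.2.1)).card := by
  refine card_le_card_of_injOn (fun a => ((a.1.1, a.1.2.2, a.1.2.1), a.2)) ?_ ?_
  · rintro ⟨⟨z, x, y⟩, d⟩ h
    rw [mem_coe, mem_filter, mem_product, mem_filter] at h
    obtain ⟨⟨⟨hmem, hx, hy, hxy, havoid⟩, hd⟩, hpos, hret⟩ := h
    simp only [mem_product, mem_univ, and_true] at hmem
    dsimp only at hx hy hxy havoid hpos hret
    simp only
    rw [mem_coe, mem_filter, mem_product, mem_filter]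
    simp only [mem_product, mem_univ, and_true]
    exact ⟨⟨⟨hmem, hy, hx, fun h => hxy h.symm, fun i hi => ⟨(havoid i hi).2, (havoid i hi).1⟩⟩, hd⟩, hpos, hret⟩
  · rintro ⟨⟨z₁, x₁, y₁⟩, d₁⟩ - ⟨⟨z₂, x₂, y₂⟩, d₂⟩ - h
    simp only [Prod.mk.injEq] at h
    obtain ⟨⟨rfl, rfl, rfl⟩, rfl⟩ := h
    rfl

/-- **`Ret₁(P'_D) ≤ (N − 1) · RetD`.**  Each `D`-avoiding return `(z, d, p)` carries at most `|Fix z| − 1 ≤ N − 1` partners `y`. -/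
theorem retLocal_fst_le (μ : Fin 3 → Equiv.Perm (Fin n)) (D : Finset (Fin n)) (ℓ N : ℕ)
    (hN : ∀ z ∈ ((univ : Finset (List.Vector (Fin 3) ℓ)).image (fun v => v.toList)).filter
        (fun z => List.IsChain (· ≠ ·) (z ++ z)),
      ((univ : Finset (Fin n)).filter (fun x => z.foldl (fun v c => μ c v) x = x)).card ≤ N) :
    ((((((univ : Finset (List.Vector (Fin 3) ℓ)).image (fun v => v.toList)).filter
        (fun z => List.IsChain (· ≠ ·) (z ++ z))) ×ˢ (univ : Finset (Fin n)) ×ˢ (univ : Finset (Fin n))).filter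
        (fun t => t.1.foldl (fun v c => μ c v) t.2.1 = t.2.1 ∧ t.1.foldl (fun v c => μ c v) t.2.2 = t.2.2 ∧ t.2.1 ≠ t.2.2 ∧
          ∀ i < ℓ, (t.1.take i).foldl (fun v c => μ c v) t.2.1 ∉ D ∧ (t.1.take i).foldl (fun v c => μ c v) t.2.2 ∉ D) ×ˢ
        range ℓ).filter (fun a => 0 < a.2 ∧ (a.1.1.take a.2).foldl (fun v c => μ c v) a.1.2.1 = a.1.2.1)).card ≤
      (N - 1) * (((((univ : Finset (List.Vector (Fin 3) ℓ)).image (fun v => v.toList)).filter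
        (fun z => List.IsChain (· ≠ ·) (z ++ z))) ×ˢ range ℓ ×ˢ (univ : Finset (Fin n))).filter (fun t =>
          0 < t.2.1 ∧ t.1.foldl (fun v c => μ c v) t.2.2 = t.2.2 ∧ (t.1.take t.2.1).foldl (fun v c => μ c v) t.2.2 = t.2.2 ∧
          ∀ i < ℓ, (t.1.take i).foldl (fun v c => μ c v) t.2.2 ∉ D)).card := by
  classical
  set W := ((univ : Finset (List.Vector (Fin 3) ℓ)).image (fun v => v.toList)).filter
    (fun z => List.IsChain (· ≠ ·) (z ++ z)) with hW
  set PD := (W ×ˢ (univ : Finset (Fin n)) ×ˢ (univ : Finset (Fin n))).filter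
    (fun t => t.1.foldl (fun v c => μ c v) t.2.1 = t.2.1 ∧ t.1.foldl (fun v c => μ c v) t.2.2 = t.2.2 ∧ t.2.1 ≠ t.2.2 ∧
      ∀ i < ℓ, (t.1.take i).foldl (fun v c => μ c v) t.2.1 ∉ D ∧ (t.1.take i).foldl (fun v c => μ c v) t.2.2 ∉ D) with hPD
  set S := (PD ×ˢ range ℓ).filter (fun a => 0 < a.2 ∧ (a.1.1.take a.2).foldl (fun v c => μ c v) a.1.2.1 = a.1.2.1) with hS
  set Ret := ((W ×ˢ range ℓ ×ˢ (univ : Finset (Fin n))).filter (fun t =>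
    0 < t.2.1 ∧ t.1.foldl (fun v c => μ c v) t.2.2 = t.2.2 ∧ (t.1.take t.2.1).foldl (fun v c => μ c v) t.2.2 = t.2.2 ∧
    ∀ i < ℓ, (t.1.take i).foldl (fun v c => μ c v) t.2.2 ∉ D)) with hRet
  -- fibre over the return `(z, d, p)`
  have hfib : ∀ r ∈ Ret, (S.filter (fun a => (a.1.1, a.2, a.1.2.1) = r)).card ≤ N - 1 := by
    rintro ⟨z, d, p⟩ hr
    rw [hRet, mem_filter] at hr
    obtain ⟨hmem, -, hp, -, -⟩ := hr
    simp only [mem_product, mem_univ, and_true, mem_range] at hmem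
    obtain ⟨hz, -⟩ := hmem
    dsimp only at hp hz
    have hsub : (S.filter (fun a => (a.1.1, a.2, a.1.2.1) = ((z, d, p) : List (Fin 3) × ℕ × Fin n))).card ≤
        (((univ : Finset (Fin n)).filter (fun x => z.foldl (fun v c => μ c v) x = x)).erase p).card := by
      refine card_le_card_of_injOn (fun a => a.1.2.2) ?_ ?_
      · rintro ⟨⟨z', p', y⟩, d'⟩ h
        rw [mem_coe, mem_filter, hS, mem_filter, mem_product, hPD, mem_filter] at h
        obtain ⟨⟨⟨⟨-, -, hy, hpy, -⟩, -⟩, -, -⟩, heq⟩ := h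
        simp only [Prod.mk.injEq] at heq
        obtain ⟨rfl, rfl, rfl⟩ := heq
        dsimp only at hy hpy ⊢
        rw [mem_coe, mem_erase, mem_filter]
        exact ⟨fun h => hpy h.symm, mem_univ _, hy⟩
      · rintro ⟨⟨z₁, p₁, y₁⟩, d₁⟩ h₁ ⟨⟨z₂, p₂, y₂⟩, d₂⟩ h₂ (hy : y₁ = y₂)
        rw [mem_coe, mem_filter] at h₁ h₂
        have e₁ := h₁.2
        have e₂ := h₂.2
        simp only [Prod.mk.injEq] at e₁ e₂
        obtain ⟨rfl, rfl, rfl⟩ := e₁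
        obtain ⟨rfl, rfl, rfl⟩ := e₂
        rw [hy]
    refine hsub.trans ?_
    have hpmem : p ∈ (univ : Finset (Fin n)).filter (fun x => z.foldl (fun v c => μ c v) x = x) :=
      mem_filter.2 ⟨mem_univ _, hp⟩
    rw [card_erase_of_mem hpmem]
    exact Nat.sub_le_sub_right (hN z hz) 1
  -- every element of `S` lies over a `D`-avoiding return
  have hmap : ∀ a ∈ S, (a.1.1, a.2, a.1.2.1) ∈ Ret := by
    rintro ⟨⟨z, p, y⟩, d⟩ h
    rw [hS, mem_filter, mem_product, hPD, mem_filter] at h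
    obtain ⟨⟨⟨hmem, hp, -, -, havoid⟩, hd⟩, hpos, hpd⟩ := h
    simp only [mem_product, mem_univ, and_true] at hmem
    dsimp only at hp havoid hpos hpd
    rw [hRet, mem_filter]
    simp only [mem_product, mem_univ, and_true, mem_range]
    exact ⟨⟨hmem, mem_range.1 hd⟩, hpos, hp, hpd, fun i hi => (havoid i hi).1⟩
  calc S.card = ∑ r ∈ Ret, (S.filter (fun a => (a.1.1, a.2, a.1.2.1) = r)).card := card_eq_sum_card_fiberwise hmap
    _ ≤ ∑ _r ∈ Ret, (N - 1) := sum_le_sum hfib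
    _ = (N - 1) * Ret.card := by rw [sum_const, smul_eq_mul, mul_comm]

/-- **`RetD ≤ Σ_{d<ℓ} Σ_p cwᴰ_d(p) · cwᴰ_{ℓ−d}(p)`.**  A `D`-avoiding return `(z, d, p)` splits `z = z.take d ++ z.drop d` into two reduced
words closed at `p` whose trajectories from `p` are initial and final segments of the (periodic, `D`-avoiding) trajectory of `p`. -/
theorem retD_le_sum (μ : Fin 3 → Equiv.Perm (Fin n)) (D : Finset (Fin n)) (ℓ : ℕ) :
    (((((univ : Finset (List.Vector (Fin 3) ℓ)).image (fun v => v.toList)).filter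
        (fun z => List.IsChain (· ≠ ·) (z ++ z))) ×ˢ range ℓ ×ˢ (univ : Finset (Fin n))).filter (fun t =>
          0 < t.2.1 ∧ t.1.foldl (fun v c => μ c v) t.2.2 = t.2.2 ∧ (t.1.take t.2.1).foldl (fun v c => μ c v) t.2.2 = t.2.2 ∧
          ∀ i < ℓ, (t.1.take i).foldl (fun v c => μ c v) t.2.2 ∉ D)).card ≤
      ∑ d ∈ range ℓ, ∑ p : Fin n,
        (((univ : Finset (List.Vector (Fin 3) d)).image (fun v => v.toList)).filter
            (fun g => List.IsChain (· ≠ ·) g ∧ g.foldl (fun v c => μ c v) p = p ∧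
              ∀ i ≤ d, (g.take i).foldl (fun v c => μ c v) p ∉ D)).card *
          (((univ : Finset (List.Vector (Fin 3) (ℓ - d))).image (fun v => v.toList)).filter
            (fun g => List.IsChain (· ≠ ·) g ∧ g.foldl (fun v c => μ c v) p = p ∧
              ∀ i ≤ ℓ - d, (g.take i).foldl (fun v c => μ c v) p ∉ D)).card := by
  classical
  set W := ((univ : Finset (List.Vector (Fin 3) ℓ)).image (fun v => v.toList)).filter
    (fun z => List.IsChain (· ≠ ·) (z ++ z)) with hW
  set Ret := ((W ×ˢ range ℓ ×ˢ (univ : Finset (Fin n))).filter (fun t =>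
    0 < t.2.1 ∧ t.1.foldl (fun v c => μ c v) t.2.2 = t.2.2 ∧ (t.1.take t.2.1).foldl (fun v c => μ c v) t.2.2 = t.2.2 ∧
    ∀ i < ℓ, (t.1.take i).foldl (fun v c => μ c v) t.2.2 ∉ D)) with hRet
  set cw : ℕ → Fin n → Finset (List (Fin 3)) := fun d p =>
    ((univ : Finset (List.Vector (Fin 3) d)).image (fun v => v.toList)).filter
      (fun g => List.IsChain (· ≠ ·) g ∧ g.foldl (fun v c => μ c v) p = p ∧
        ∀ i ≤ d, (g.take i).foldl (fun v c => μ c v) p ∉ D) with hcw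
  have mem_cw : ∀ {d : ℕ} {p : Fin n} {g : List (Fin 3)}, g ∈ cw d p ↔ g.length = d ∧ List.IsChain (· ≠ ·) g ∧
      g.foldl (fun v c => μ c v) p = p ∧ ∀ i ≤ d, (g.take i).foldl (fun v c => μ c v) p ∉ D := by
    intro d p g
    rw [hcw, mem_filter, mem_words]
  have htarget : (((range ℓ) ×ˢ (univ : Finset (Fin n))).sigma
      (fun dp => cw dp.1 dp.2 ×ˢ cw (ℓ - dp.1) dp.2)).card =
      ∑ d ∈ range ℓ, ∑ p : Fin n, (cw d p).card * (cw (ℓ - d) p).card := by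
    rw [card_sigma, sum_product]
    simp only [card_product]
  show Ret.card ≤ ∑ d ∈ range ℓ, ∑ p : Fin n, (cw d p).card * (cw (ℓ - d) p).card
  rw [← htarget]
  refine card_le_card_of_injOn (fun t => ⟨(t.2.1, t.2.2), (t.1.take t.2.1, t.1.drop t.2.1)⟩) ?_ ?_
  · rintro ⟨z, d, p⟩ h
    rw [mem_coe, hRet, mem_filter] at h
    obtain ⟨hmem, hd, hp, hpd, havoid⟩ := h
    simp only [mem_product, mem_univ, and_true, mem_range] at hmem
    obtain ⟨hz, hdℓ⟩ := hmem
    dsimp only at hd hp hpd hz hdℓ havoid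
    obtain ⟨hzl, hchain⟩ := mem_cycWords.1 hz
    have hred : List.IsChain (· ≠ ·) z := hchain.left_of_append
    simp only [mem_coe, mem_sigma, mem_product, mem_univ, and_true, mem_range]
    refine ⟨hdℓ, ?_, ?_⟩
    · rw [mem_cw]
      refine ⟨by rw [List.length_take]; omega, ?_, hpd, ?_⟩
      · rw [← List.take_append_drop d z] at hred
        exact hred.left_of_append
      · intro i hi
        rw [List.take_take, Nat.min_eq_left hi]
        exact havoid i (by omega)
    · rw [mem_cw]
      refine ⟨by rw [List.length_drop, hzl], ?_, ?_, ?_⟩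
      · rw [← List.take_append_drop d z] at hred
        exact hred.right_of_append
      · have h := hp
        rw [← List.take_append_drop d z, List.foldl_append, hpd] at h
        exact h
      · intro i hi
        -- the `i`-th point of `z.drop d` from `p` is the `(d + i)`-th point of `z` from `p`
        have h1 : ((z.drop d).take i).foldl (fun v c => μ c v) p = (z.take (d + i)).foldl (fun v c => μ c v) p := by
          conv_rhs => rw [List.take_add, List.foldl_append, hpd]
        rw [h1]
        rcases Nat.lt_or_ge (d + i) ℓ with hlt | hge
        · exact havoid _ hlt
        · have : d + i = ℓ := by omega
          rw [this, ← hzl, List.take_length, hp]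
          have h0 := havoid 0 (by omega)
          simpa using h0
  · rintro ⟨z₁, d₁, p₁⟩ - ⟨z₂, d₂, p₂⟩ - heq
    simp only [Sigma.mk.injEq, Prod.mk.injEq] at heq
    obtain ⟨⟨rfl, rfl⟩, h⟩ := heq
    rw [heq_iff_eq, Prod.mk.injEq] at h
    obtain ⟨ht, hdr⟩ := h
    have : z₁ = z₂ := by rw [← List.take_append_drop d₁ z₁, ht, hdr, List.take_append_drop]
    rw [this]

/-- **Registered form** (`stub_twinReturnBoundLocal`, a `--supports` sub-goal of crux stmt-MatrixMultiplication-10883): inside the family of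
twin pre-pairs avoiding `D`, the returns of the first point number at most `(N − 1) · Σ_{d<ℓ} Σ_p cwᴰ_d(p)·cwᴰ_{ℓ−d}(p)` — poorness `N` times
`D`-avoiding closed-walk counts (`retLocal_fst_le` + `retD_le_sum`); with `retLocal_snd_le_fst` the same bounds the second point's returns. -/
theorem stub_twinReturnBoundLocal : ∀ (n ℓ N : ℕ) (μ : Fin 3 → Equiv.Perm (Fin n)) (D : Finset (Fin n)), (∀ z ∈ (((Finset.univ : Finset (List.Vector (Fin 3) ℓ)).image (fun v => v.toList)).filter (fun z => List.IsChain (· ≠ ·) (z ++ z))), ((Finset.univ : Finset (Fin n)).filter (fun x => z.foldl (fun v c => μ c v) x = x)).card ≤ N) → (((((((Finset.univ : Finset (List.Vector (Fin 3) ℓ)).image (fun v => v.toList)).filter (fun z => List.IsChain (· ≠ ·) (z ++ z))) ×ˢ (Finset.univ : Finset (Fin n)) ×ˢ (Finset.univ : Finset (Fin n))).filter (fun t => t.1.foldl (fun v c => μ c v) t.2.1 = t.2.1 ∧ t.1.foldl (fun v c => μ c v) t.2.2 = t.2.2 ∧ t.2.1 ≠ t.2.2 ∧ ∀ i < ℓ,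 (t.1.take i).foldl (fun v c => μ c v) t.2.1 ∉ D ∧ (t.1.take i).foldl (fun v c => μ c v) t.2.2 ∉ D)) ×ˢ Finset.range ℓ).filter (fun a => 0 < a.2 ∧ (a.1.1.take a.2).foldl (fun v c => μ c v) a.1.2.1 = a.1.2.1)).card ≤ (N - 1) * ∑ d ∈ Finset.range ℓ, ∑ p : Fin n, (((Finset.univ : Finset (List.Vector (Fin 3) d)).image (fun v => v.toList)).filter (fun g => List.IsChain (· ≠ ·) g ∧ g.foldl (fun v c => μ c v) p = p ∧ ∀ i ≤ d, (g.take i).foldl (fun v c => μ c v) p ∉ D)).card * (((Finset.univ : Finset (List.Vector (Fin 3) (ℓ - d))).image (fun v => v.toList)).filter (fun g => List.IsChain (· ≠ ·) g ∧ g.foldl (fun v c => μ c v) p = p ∧ ∀ i ≤ (ℓ - d), (g.take i).foldl (fun v c => μ c v) p ∉ D)).card :=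
  fun _ ℓ N μ D hN => (retLocal_fst_le μ D ℓ N hN).trans (Nat.mul_le_mul_left _ (retD_le_sum μ D ℓ))

end TwinsEll2

end Summit.MatrixMultiplication.MatrixMultiplication.Theorems.HyperoctahedralThreshold
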